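import Mathlib
import Literature.Analysis.FluidPDE.TorusNSWienerAlgebraBlowupRate
import Literature.Analysis.FunctionSpaces.TorusSobolevNormEmbeddingProofs
import Literature.Analysis.FunctionSpaces.LatticeSobolev
import Summits.NavierStokesRegularity.FluidComputer.ConvectiveProductLawLattice
import HarnessLib

/-!
# The convective product law `H² · H² → H¹`: the booking-norm (`κ`-bracket) instances, the tree's
# Sobolev-norm form `‖(u·∇)v‖_{H¹} ≤ 4πσ ‖u‖_{H²} ‖v‖_{H²}`, `σ² < ∞` in `d ≤ 3`, and the modewise
# Leray contraction (lean g6, cell `ns-blowup`, 2026-08-26)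

HONEST FRAMING (human ruling D-0035): nothing here is a claim about Navier–Stokes blow-up.
WHAT THIS IS NOT: not NS evidence — inequalities between Fourier coefficients of smooth fields on
the flat torus `T^d = (ℝ/ℤ)^d` and between `ℝ≥0∞` lattice sums. Third file of the kernel form of the
displayed constant `c_alg = 2σ` of the R-β chain (`HOME/instab/C-ALG-DISPLAY.md`, INSTAB-BRIDGE §13
(b)(ii)), after instab g12's `ConvectiveProductLawLattice` (p430117: abstract subadditive weight `w`,
`∑(w f)² ≤ 4(∑w⁻⁴)(∑(w²v)²)(∑(w²u)²)` under convective domination) and `ConvectiveProductLawTorus`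
(p430818: the torus dictionary with `⟨l⟩` and the `κ = 1` `eNormSq` bound); items (b′), (c), (e),
(f), (g) handed to this seat in STATUS 07:53Z:

* `enorm_mFourierCoeff_convect_le_freq` — the dictionary with the bare frequency length `|l|`
  (`‖𝓕(ℂ∘(u·∇)v)(k)‖ ≤ 2π ∑ₗ ‖û(k−l)‖ |l| ‖v̂(l)‖`, the tree's SHARP
  `NSWiener.norm_mFourierCoeff_convect_le_adv` re-indexed in `ℝ≥0∞`; `|l| ≤ ⟨l⟩`, so this is the form
  every weight `w ≥ |·|` can use, in particular the `κ`-brackets with `κ < 1`).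
* (b′) `weighted_tsum_sq_mFourierCoeff_convect_le` — torus sentence for ANY weight `0 < w < ∞` with
  `w(k) ≤ w(k−l) + w(l)`, `|l| ≤ w(l)`:
  `∑ₖ (w(k)‖𝓕((u·∇)v)(k)‖)² ≤ (2π)² · 4 (∑ w⁻⁴) (∑ (w²‖û‖)²) (∑ (w²‖v̂‖)²)`.
* (c) the BOOKING bracket `w_κ = (κ² + |k|²)^{1/2}`, `κ > 0`: LATTICE form
  `kappaWeight_tsum_sq_le_of_freq_domination` — for sizes with `f(k) ≤ ∑ₗ v(k−l) |l| u(l)` (the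
  convective domination with symbol `i k`, i.e. fields on `(ℝ/2πℤ)³` in the memo's `⨍`-convention):
  `∑ₖ (κ²+|k|²) f(k)² ≤ 4 σ_κ² (∑(κ²+|l|²)² v²)(∑(κ²+|l|²)² u²)`, `σ_κ² = ∑ₗ (κ²+|l|²)⁻²` — LITERALLY
  the memo's `‖(v·∇)w‖_{H¹_κ} ≤ 2σ_κ ‖v‖_{g_κ} ‖w‖_{g_κ}`; and the unit-torus form
  `kappaWeight_tsum_sq_mFourierCoeff_convect_le` with `(2π)²·4σ_κ²` (symbol `2πi k`: under `x = 2πy`,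
  `(V·∇_y)W = 2π (v·∇ₓ)w` and `V̂ = v̂`, so the two agree).
* (g) `eNormSq_one_mFourierCoeff_convect_le`, `eSobolevNorm_one_convect_le` — `κ = 1` in the tree's
  vocabulary, norm form: `‖(u·∇)v‖_{H¹} ≤ 4π σ ‖u‖_{H²} ‖v‖_{H²}` (`Torus.eSobolevNorm`).
* (e) `tsum_kappaWeight_inv_sq_lt_top`, `tsum_sobolevWeight_neg_two_sq_lt_top` — `σ_κ² < ∞` for
  `card d ≤ 3` (`Torus.summable_one_add_freqNormSq_rpow_neg_of_lt`). The VALUE (`σ₁₀² = π²/10` on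
  `(ℝ/2πℤ)³` by Poisson summation, memo §3) stays outside the kernel (refuter2, STATUS l.2692).
* (f) `norm_lerayMode_le`, `tsum_weight_mul_lerayMode_sq_le` — the Leray symbol
  `z ↦ z − (k·z/|k|²) k` is a contraction on every mode, hence on every weighted coefficient norm
  (memo §2 (vi); the tree's physical-space forms are `Torus.integral_norm_sq_sub_gradient_invLaplacian_divergence_le`,
  `Torus.gradNormSq_sub_gradient_invLaplacian_divergence_le`).

References: C-ALG-DISPLAY.md (instab g12) §1–§3, §5; C. Foias, R. Temam, J. Funct. Anal. 87 (1989),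
§2 (2.6) [FoiasTemam1989]; J. C. Robinson, J. L. Rodrigo, W. Sadowski, CUP 2016, Thm. 2.6 (the
Helmholtz split on one frequency) [RobinsonRodrigoSadowski2016]; P. Constantin, C. Foias (1988), Ch. 6
[ConstantinFoiasNSE1988].
-/

noncomputable section

namespace Summit.NavierStokesRegularity.FluidComputer.ConvectiveProductLawBooking

open MeasureTheory UnitAddTorus Function Finset
open Literature.Analysis.FunctionSpaces Literature.Analysis.FunctionSpaces.Torus
open Literature.Analysis.FunctionSpaces.Lattice (eNormSq eNorm)
open Literature.Analysis.FluidPDE Literature.Analysis.FluidPDE.NSGevrey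
open Literature.Analysis.FluidPDE.NSWiener
open Summit.NavierStokesRegularity.FluidComputer.ConvectiveProductLawLattice
open scoped ENNReal NNReal Topology BigOperators

variable {d : Type*} [Fintype d] [DecidableEq d]

/-! ## §1 The dictionary: coefficients of `(u·∇)v` are convectively dominated (sharp constant) -/

section Dictionary

variable {u v : UnitAddTorus d → EuclideanSpace ℝ d}

/-- **The dictionary in `ℝ≥0∞`, indexed by the frequency of `v̂`**: for smooth real `u, v` on `T^d`,
`‖𝓕(ℂ∘(u·∇)v)(k)‖ₑ ≤ 2π ∑ₗ ‖û(k − l)‖ₑ · |l| · ‖v̂(l)‖ₑ` — the CONVECTIVE DOMINATION hypothesis of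
`ConvectiveProductLawLattice.weighted_tsum_sq_le_of_convective_domination` (up to `2π`, and with
`|l| ≤ w(l)` still to be used). The real, `m`-indexed form with the SHARP constant (Cauchy–Schwarz
on `(k−m)·û(m)`, no `(card d)²`) is the tree's `NSWiener.norm_mFourierCoeff_convect_le_adv`. -/
theorem enorm_mFourierCoeff_convect_le_freq (hu : IsSmooth u) (hv : IsSmooth v) (k : d → ℤ) :
    ‖mFourierCoeff (EuclideanSpace.complexify ∘ Torus.convect u v) k‖ₑ ≤
      ENNReal.ofReal (2 * Real.pi) *
        ∑' l : d → ℤ, ‖mFourierCoeff (EuclideanSpace.complexify ∘ u) (k - l)‖ₑ *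
          (ENNReal.ofReal (Real.sqrt (freqNormSq l)) *
            ‖mFourierCoeff (EuclideanSpace.complexify ∘ v) l‖ₑ) := by
  set U : (d → ℤ) → EuclideanSpace ℂ d := fun m => mFourierCoeff (EuclideanSpace.complexify ∘ u) m
    with hU
  set V : (d → ℤ) → EuclideanSpace ℂ d := fun m => mFourierCoeff (EuclideanSpace.complexify ∘ v) m
    with hV
  have h := NSWiener.norm_mFourierCoeff_convect_le_adv hu hv k
  have hS : Summable fun m : d → ℤ => ‖U m‖ * (Real.sqrt (freqNormSq (k - m)) * ‖V (k - m)‖) :=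
    summable_convectMajorant hu hv k
  have hnn : ∀ m : d → ℤ, 0 ≤ ‖U m‖ * (Real.sqrt (freqNormSq (k - m)) * ‖V (k - m)‖) := fun m =>
    mul_nonneg (norm_nonneg _) (mul_nonneg (Real.sqrt_nonneg _) (norm_nonneg _))
  -- the real series, written in `ℝ≥0∞` and re-indexed by `l = k - m`
  have hsum : ENNReal.ofReal (∑' m : d → ℤ, ‖U m‖ * (Real.sqrt (freqNormSq (k - m)) * ‖V (k - m)‖)) =
      ∑' l : d → ℤ, ‖U (k - l)‖ₑ * (ENNReal.ofReal (Real.sqrt (freqNormSq l)) * ‖V l‖ₑ) := by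
    rw [ENNReal.ofReal_tsum_of_nonneg hnn hS]
    rw [← Lattice.tsum_sub_left_eq
      (fun m : d → ℤ => ENNReal.ofReal (‖U m‖ * (Real.sqrt (freqNormSq (k - m)) * ‖V (k - m)‖))) k]
    refine tsum_congr fun l => ?_
    rw [sub_sub_cancel, ENNReal.ofReal_mul (norm_nonneg _),
      ENNReal.ofReal_mul (Real.sqrt_nonneg _), ofReal_norm, ofReal_norm]
  calc ‖mFourierCoeff (EuclideanSpace.complexify ∘ Torus.convect u v) k‖ₑ
      = ENNReal.ofReal ‖mFourierCoeff (EuclideanSpace.complexify ∘ Torus.convect u v) k‖ :=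
        (ofReal_norm _).symm
    _ ≤ ENNReal.ofReal (2 * Real.pi *
          ∑' m : d → ℤ, ‖U m‖ * (Real.sqrt (freqNormSq (k - m)) * ‖V (k - m)‖)) :=
        ENNReal.ofReal_le_ofReal h
    _ = _ := by rw [ENNReal.ofReal_mul (by positivity), hsum]

/-! ## §2 End-to-end: the weighted `H¹`-type norm of `(u·∇)v`, abstract weight -/

/-- **The convective product law on the torus, abstract weight**: for smooth real `u, v` on `T^d`
and every weight `0 < w < ∞` on `ℤ^d` that is subadditive, `w(k) ≤ w(k − l) + w(l)`, and
dominates the frequency length, `|l| ≤ w(l)`: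
`∑ₖ (w(k) ‖𝓕(ℂ∘(u·∇)v)(k)‖)² ≤ (2π)² · 4 (∑ₗ w(l)⁻⁴) · (∑ₗ (w(l)² ‖û(l)‖)²) · (∑ₗ (w(l)² ‖v̂(l)‖)²)`,
i.e. `‖(u·∇)v‖_{w} ≤ 2π · 2σ ‖u‖_{w²} ‖v‖_{w²}` with `σ² = ∑ w⁻⁴` (C-ALG-DISPLAY §2 (i)–(vi):
the dictionary above fed into `ConvectiveProductLawLattice.weighted_tsum_sq_le_of_convective_domination`). -/
theorem weighted_tsum_sq_mFourierCoeff_convect_le (hu : IsSmooth u) (hv : IsSmooth v)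
    (w : (d → ℤ) → ℝ≥0∞) (hw0 : ∀ k, w k ≠ 0) (hwt : ∀ k, w k ≠ ∞)
    (hsub : ∀ k l, w k ≤ w (k - l) + w l)
    (hfreq : ∀ l, ENNReal.ofReal (Real.sqrt (freqNormSq l)) ≤ w l) :
    ∑' k : d → ℤ, (w k * ‖mFourierCoeff (EuclideanSpace.complexify ∘ Torus.convect u v) k‖ₑ) ^ 2 ≤
      ENNReal.ofReal (2 * Real.pi) ^ 2 * (4 * (∑' l : d → ℤ, (w l)⁻¹ ^ 4) *
        ((∑' l : d → ℤ, (w l ^ 2 * ‖mFourierCoeff (EuclideanSpace.complexify ∘ u) l‖ₑ) ^ 2) *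
          ∑' l : d → ℤ, (w l ^ 2 * ‖mFourierCoeff (EuclideanSpace.complexify ∘ v) l‖ₑ) ^ 2)) := by
  set U : (d → ℤ) → EuclideanSpace ℂ d := fun m => mFourierCoeff (EuclideanSpace.complexify ∘ u) m
    with hU
  set V : (d → ℤ) → EuclideanSpace ℂ d := fun m => mFourierCoeff (EuclideanSpace.complexify ∘ v) m
    with hV
  set C : ℝ≥0∞ := ENNReal.ofReal (2 * Real.pi) with hC
  have hC0 : C ≠ 0 := (ENNReal.ofReal_pos.2 (by positivity)).ne'
  have hCt : C ≠ ∞ := ENNReal.ofReal_ne_top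
  -- the normalised sizes `f k = (2π)⁻¹ ‖𝓕((u·∇)v)(k)‖`
  set f : (d → ℤ) → ℝ≥0∞ := fun k =>
    C⁻¹ * ‖mFourierCoeff (EuclideanSpace.complexify ∘ Torus.convect u v) k‖ₑ with hf
  have hf_dom : ∀ k, f k ≤ ∑' l, ‖U (k - l)‖ₑ * (w l * ‖V l‖ₑ) := by
    intro k
    simp only [hf]
    calc C⁻¹ * ‖mFourierCoeff (EuclideanSpace.complexify ∘ Torus.convect u v) k‖ₑ
        ≤ C⁻¹ * (C * ∑' l : d → ℤ, ‖U (k - l)‖ₑ *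
          (ENNReal.ofReal (Real.sqrt (freqNormSq l)) * ‖V l‖ₑ)) := by
          gcongr; exact enorm_mFourierCoeff_convect_le_freq hu hv k
      _ = ∑' l : d → ℤ, ‖U (k - l)‖ₑ * (ENNReal.ofReal (Real.sqrt (freqNormSq l)) * ‖V l‖ₑ) := by
          rw [← mul_assoc, ENNReal.inv_mul_cancel hC0 hCt, one_mul]
      _ ≤ ∑' l, ‖U (k - l)‖ₑ * (w l * ‖V l‖ₑ) :=
          ENNReal.tsum_le_tsum fun l => by gcongr; exact hfreq l
  have h := weighted_tsum_sq_le_of_convective_domination w (fun l => ‖U l‖ₑ) (fun l => ‖V l‖ₑ) f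
    hw0 hwt hsub hf_dom
  have hCf : ∀ k, ‖mFourierCoeff (EuclideanSpace.complexify ∘ Torus.convect u v) k‖ₑ = C * f k := by
    intro k
    rw [hf, ← mul_assoc, ENNReal.mul_inv_cancel hC0 hCt, one_mul]
  calc ∑' k : d → ℤ, (w k * ‖mFourierCoeff (EuclideanSpace.complexify ∘ Torus.convect u v) k‖ₑ) ^ 2
      = ∑' k : d → ℤ, C ^ 2 * (w k * f k) ^ 2 := tsum_congr fun k => by rw [hCf k]; ring
    _ = C ^ 2 * ∑' k : d → ℤ, (w k * f k) ^ 2 := ENNReal.tsum_mul_left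
    _ ≤ C ^ 2 * (4 * (∑' l : d → ℤ, (w l)⁻¹ ^ 4) *
          ((∑' l : d → ℤ, (w l ^ 2 * ‖U l‖ₑ) ^ 2) * ∑' l : d → ℤ, (w l ^ 2 * ‖V l‖ₑ) ^ 2)) := by
        gcongr

end Dictionary

/-! ## §3 The `κ`-bracket `w_κ = (κ² + |k|²)^{1/2}` (the booking norms `H¹_κ`, `g_κ`) -/

section Kappa

omit [DecidableEq d] in
/-- `κ² + |k|² > 0` for `κ > 0`. -/
theorem kappa_sq_add_freqNormSq_pos {κ : ℝ} (hκ : 0 < κ) (k : d → ℤ) : 0 < κ ^ 2 + freqNormSq k := by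
  have := freqNormSq_nonneg k; positivity

omit [DecidableEq d] in
/-- **Subadditivity of the `κ`-bracket**: `(κ² + |k|²)^{1/2} ≤ (κ² + |k−l|²)^{1/2} + (κ² + |l|²)^{1/2}`
(`|k| ≤ |k − l| + |l|` and `(A + B)² ≥ κ² + (|k−l| + |l|)²` for `A ≥ |k−l|`, `B ≥ |l|`,
`A² = κ² + |k−l|²`, `B² = κ² + |l|²`; C-ALG-DISPLAY §2 (ii)). -/
theorem sqrt_kappa_sq_add_freqNormSq_le_sub_add (κ : ℝ) (k l : d → ℤ) :
    Real.sqrt (κ ^ 2 + freqNormSq k) ≤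
      Real.sqrt (κ ^ 2 + freqNormSq (k - l)) + Real.sqrt (κ ^ 2 + freqNormSq l) := by
  set a := Real.sqrt (freqNormSq (k - l)) with ha
  set b := Real.sqrt (freqNormSq l) with hb
  set A := Real.sqrt (κ ^ 2 + freqNormSq (k - l)) with hA
  set B := Real.sqrt (κ ^ 2 + freqNormSq l) with hB
  have ha0 : 0 ≤ a := Real.sqrt_nonneg _
  have hb0 : 0 ≤ b := Real.sqrt_nonneg _
  have hA0 : 0 ≤ A := Real.sqrt_nonneg _
  have hB0 : 0 ≤ B := Real.sqrt_nonneg _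
  have ha2 : a ^ 2 = freqNormSq (k - l) := Real.sq_sqrt (freqNormSq_nonneg _)
  have hb2 : b ^ 2 = freqNormSq l := Real.sq_sqrt (freqNormSq_nonneg _)
  have hA2 : A ^ 2 = κ ^ 2 + freqNormSq (k - l) :=
    Real.sq_sqrt (by have := freqNormSq_nonneg (k - l); positivity)
  have hB2 : B ^ 2 = κ ^ 2 + freqNormSq l := Real.sq_sqrt (by have := freqNormSq_nonneg l; positivity)
  have haA : a ≤ A := Real.sqrt_le_sqrt (by nlinarith [sq_nonneg κ])
  have hbB : b ≤ B := Real.sqrt_le_sqrt (by nlinarith [sq_nonneg κ])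
  have hk : Real.sqrt (freqNormSq k) ≤ a + b := by
    have h := sqrt_freqNormSq_add_le (k - l) l
    rwa [sub_add_cancel] at h
  have hk2 : freqNormSq k ≤ (a + b) ^ 2 := by
    have h0 : 0 ≤ Real.sqrt (freqNormSq k) := Real.sqrt_nonneg _
    have h1 : Real.sqrt (freqNormSq k) ^ 2 = freqNormSq k := Real.sq_sqrt (freqNormSq_nonneg _)
    nlinarith [hk, h0, h1]
  have hab : a * b ≤ A * B := mul_le_mul haA hbB hb0 hA0
  rw [Real.sqrt_le_left (by positivity)]
  nlinarith [hab, hk2, hA2, hB2, sq_nonneg κ]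

omit [DecidableEq d] in
/-- **The memo's CLAIM, literally, on coefficient sizes** (C-ALG-DISPLAY §1: symbol `i k`, i.e.
fields on `(ℝ/2πℤ)³` with the `⨍`-normalised coefficients): for `κ > 0` and sizes
`v, u, f : ℤ^d → [0, ∞]` with the convective domination `f(k) ≤ ∑ₗ v(k−l) · |l| · u(l)`,
`∑ₖ (κ² + |k|²) f(k)² ≤ 4 σ_κ² (∑ₗ (κ²+|l|²)² v(l)²) (∑ₗ (κ²+|l|²)² u(l)²)`, `σ_κ² = ∑ₗ (κ²+|l|²)⁻²`,
i.e. `‖f‖_{H¹_κ} ≤ 2σ_κ ‖v‖_{g_κ} ‖u‖_{g_κ}` — `c_alg(κ) = 2σ_κ`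
(`ConvectiveProductLawLattice.weighted_tsum_sq_le_of_convective_domination` with `w = w_κ`). -/
theorem kappaWeight_tsum_sq_le_of_freq_domination {κ : ℝ} (hκ : 0 < κ) (v u f : (d → ℤ) → ℝ≥0∞)
    (hf : ∀ k, f k ≤ ∑' l, v (k - l) * (ENNReal.ofReal (Real.sqrt (freqNormSq l)) * u l)) :
    ∑' k : d → ℤ, ENNReal.ofReal (κ ^ 2 + freqNormSq k) * f k ^ 2 ≤
      4 * (∑' l : d → ℤ, ENNReal.ofReal ((κ ^ 2 + freqNormSq l)⁻¹ ^ 2)) *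
        ((∑' l : d → ℤ, ENNReal.ofReal ((κ ^ 2 + freqNormSq l) ^ 2) * v l ^ 2) *
          ∑' l : d → ℤ, ENNReal.ofReal ((κ ^ 2 + freqNormSq l) ^ 2) * u l ^ 2) := by
  set w : (d → ℤ) → ℝ≥0∞ := fun k => ENNReal.ofReal (Real.sqrt (κ ^ 2 + freqNormSq k)) with hw
  have hpos : ∀ k : d → ℤ, 0 < Real.sqrt (κ ^ 2 + freqNormSq k) := fun k =>
    Real.sqrt_pos.2 (kappa_sq_add_freqNormSq_pos hκ k)
  have hw0 : ∀ k, w k ≠ 0 := fun k => (ENNReal.ofReal_pos.2 (hpos k)).ne'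
  have hwt : ∀ k, w k ≠ ∞ := fun k => ENNReal.ofReal_ne_top
  have hsub : ∀ k l, w k ≤ w (k - l) + w l := fun k l => by
    simp only [hw]
    rw [← ENNReal.ofReal_add (Real.sqrt_nonneg _) (Real.sqrt_nonneg _)]
    exact ENNReal.ofReal_le_ofReal (sqrt_kappa_sq_add_freqNormSq_le_sub_add κ k l)
  have hfreq : ∀ l, ENNReal.ofReal (Real.sqrt (freqNormSq l)) ≤ w l := fun l =>
    ENNReal.ofReal_le_ofReal (Real.sqrt_le_sqrt (by nlinarith [sq_nonneg κ]))
  have hf' : ∀ k, f k ≤ ∑' l, v (k - l) * (w l * u l) := fun k =>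
    (hf k).trans (ENNReal.tsum_le_tsum fun l => by gcongr; exact hfreq l)
  have h := weighted_tsum_sq_le_of_convective_domination w v u f hw0 hwt hsub hf'
  -- conversions between the weight `w` and the displayed real weights
  have hw2 : ∀ k : d → ℤ, w k ^ 2 = ENNReal.ofReal (κ ^ 2 + freqNormSq k) := fun k => by
    simp only [hw]
    rw [← ENNReal.ofReal_pow (Real.sqrt_nonneg _), Real.sq_sqrt (kappa_sq_add_freqNormSq_pos hκ k).le]
  have hw2' : ∀ l : d → ℤ, ENNReal.ofReal (κ ^ 2 + freqNormSq l) ^ 2 =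
      ENNReal.ofReal ((κ ^ 2 + freqNormSq l) ^ 2) := fun l =>
    (ENNReal.ofReal_pow (kappa_sq_add_freqNormSq_pos hκ l).le 2).symm
  have hw4 : ∀ l : d → ℤ, (w l)⁻¹ ^ 4 = ENNReal.ofReal ((κ ^ 2 + freqNormSq l)⁻¹ ^ 2) := fun l => by
    simp only [hw]
    rw [← ENNReal.ofReal_inv_of_pos (hpos l), ← ENNReal.ofReal_pow (inv_nonneg.2 (Real.sqrt_nonneg _))]
    congr 1
    rw [show (4 : ℕ) = 2 * 2 from rfl, pow_mul, inv_pow, Real.sq_sqrt (kappa_sq_add_freqNormSq_pos hκ l).le,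
      inv_pow]
  simp only [mul_pow, hw2, hw2', hw4] at h
  exact h

variable {u v : UnitAddTorus d → EuclideanSpace ℝ d}

/-- **The convective product law in the `κ`-bracket norms** (instab's `H¹_κ` / `g_κ` booking norms
read on the coefficients of fields on the unit torus; C-ALG-DISPLAY §1): for smooth real `u, v` on
`T^d` and `κ > 0`,
`∑ₖ (κ² + |k|²) ‖𝓕(ℂ∘(u·∇)v)(k)‖² ≤ (2π)² · 4 σ_κ² · (∑ₗ (κ²+|l|²)² ‖û(l)‖²) · (∑ₗ (κ²+|l|²)² ‖v̂(l)‖²)`,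
`σ_κ² = ∑ₗ (κ² + |l|²)⁻²` — i.e. `‖(u·∇)v‖_{H¹_κ} ≤ 2π · 2σ_κ ‖u‖_{g_κ} ‖v‖_{g_κ}` on `(ℝ/ℤ)^d`
(`= c_alg(κ) ‖v‖_{g_κ}‖w‖_{g_κ}` with `c_alg = 2σ_κ` on `(ℝ/2πℤ)³`, where the symbol is `i k`). -/
theorem kappaWeight_tsum_sq_mFourierCoeff_convect_le (hu : IsSmooth u) (hv : IsSmooth v)
    {κ : ℝ} (hκ : 0 < κ) :
    ∑' k : d → ℤ, ENNReal.ofReal (κ ^ 2 + freqNormSq k) *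
        ‖mFourierCoeff (EuclideanSpace.complexify ∘ Torus.convect u v) k‖ₑ ^ 2 ≤
      ENNReal.ofReal (2 * Real.pi) ^ 2 *
        (4 * (∑' l : d → ℤ, ENNReal.ofReal ((κ ^ 2 + freqNormSq l)⁻¹ ^ 2)) *
          ((∑' l : d → ℤ, ENNReal.ofReal ((κ ^ 2 + freqNormSq l) ^ 2) *
              ‖mFourierCoeff (EuclideanSpace.complexify ∘ u) l‖ₑ ^ 2) *
            ∑' l : d → ℤ, ENNReal.ofReal ((κ ^ 2 + freqNormSq l) ^ 2) *
              ‖mFourierCoeff (EuclideanSpace.complexify ∘ v) l‖ₑ ^ 2)) := by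
  set C : ℝ≥0∞ := ENNReal.ofReal (2 * Real.pi) with hC
  have hC0 : C ≠ 0 := (ENNReal.ofReal_pos.2 (by positivity)).ne'
  have hCt : C ≠ ∞ := ENNReal.ofReal_ne_top
  set f : (d → ℤ) → ℝ≥0∞ := fun k =>
    C⁻¹ * ‖mFourierCoeff (EuclideanSpace.complexify ∘ Torus.convect u v) k‖ₑ with hf
  have hf_dom : ∀ k, f k ≤ ∑' l, ‖mFourierCoeff (EuclideanSpace.complexify ∘ u) (k - l)‖ₑ *
      (ENNReal.ofReal (Real.sqrt (freqNormSq l)) * ‖mFourierCoeff (EuclideanSpace.complexify ∘ v) l‖ₑ) := by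
    intro k
    simp only [hf]
    calc C⁻¹ * ‖mFourierCoeff (EuclideanSpace.complexify ∘ Torus.convect u v) k‖ₑ
        ≤ C⁻¹ * (C * ∑' l : d → ℤ, ‖mFourierCoeff (EuclideanSpace.complexify ∘ u) (k - l)‖ₑ *
          (ENNReal.ofReal (Real.sqrt (freqNormSq l)) *
            ‖mFourierCoeff (EuclideanSpace.complexify ∘ v) l‖ₑ)) := by
          gcongr; exact enorm_mFourierCoeff_convect_le_freq hu hv k
      _ = _ := by rw [← mul_assoc, ENNReal.inv_mul_cancel hC0 hCt, one_mul]
  have h := kappaWeight_tsum_sq_le_of_freq_domination hκ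
    (fun l => ‖mFourierCoeff (EuclideanSpace.complexify ∘ u) l‖ₑ)
    (fun l => ‖mFourierCoeff (EuclideanSpace.complexify ∘ v) l‖ₑ) f hf_dom
  have hCf : ∀ k, ‖mFourierCoeff (EuclideanSpace.complexify ∘ Torus.convect u v) k‖ₑ = C * f k := by
    intro k
    rw [hf, ← mul_assoc, ENNReal.mul_inv_cancel hC0 hCt, one_mul]
  calc ∑' k : d → ℤ, ENNReal.ofReal (κ ^ 2 + freqNormSq k) *
        ‖mFourierCoeff (EuclideanSpace.complexify ∘ Torus.convect u v) k‖ₑ ^ 2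
      = ∑' k : d → ℤ, C ^ 2 * (ENNReal.ofReal (κ ^ 2 + freqNormSq k) * f k ^ 2) :=
        tsum_congr fun k => by rw [hCf k]; ring
    _ = C ^ 2 * ∑' k : d → ℤ, ENNReal.ofReal (κ ^ 2 + freqNormSq k) * f k ^ 2 := ENNReal.tsum_mul_left
    _ ≤ _ := by gcongr

omit [DecidableEq d] in
/-- **`σ_κ² < ∞` in dimension `≤ 3`**: `∑ₗ (κ² + |l|²)⁻² < ∞` for `κ > 0` and `card d ≤ 3`
(`(κ² + |l|²)⁻² ≤ min(1, κ²)⁻² (1 + |l|²)⁻²` and the lattice `p`-series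
`Torus.summable_one_add_freqNormSq_rpow_neg_of_lt` with `2s = 4 > card d`). The value is not
computed here. -/
theorem tsum_kappaWeight_inv_sq_lt_top (hd : Fintype.card d ≤ 3) {κ : ℝ} (hκ : 0 < κ) :
    ∑' l : d → ℤ, ENNReal.ofReal ((κ ^ 2 + freqNormSq l)⁻¹ ^ 2) < ∞ := by
  set m : ℝ := min 1 (κ ^ 2) with hm
  have hm0 : 0 < m := lt_min one_pos (by positivity)
  have hm1 : m ≤ 1 := min_le_left _ _
  have hmk : m ≤ κ ^ 2 := min_le_right _ _
  have hS : Summable fun l : d → ℤ => (1 + freqNormSq l) ^ (-(2 : ℝ)) :=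
    summable_one_add_freqNormSq_rpow_neg_of_lt (d := d) (s := 2)
      (by
        have h3 : (Fintype.card d : ℝ) ≤ 3 := by exact_mod_cast hd
        linarith)
  have hle : ∀ l : d → ℤ, (κ ^ 2 + freqNormSq l)⁻¹ ^ 2 ≤ m⁻¹ ^ 2 * (1 + freqNormSq l) ^ (-(2 : ℝ)) := by
    intro l
    have hf := freqNormSq_nonneg l
    have h1 : 0 < 1 + freqNormSq l := by linarith
    have h2 : m * (1 + freqNormSq l) ≤ κ ^ 2 + freqNormSq l := by nlinarith
    have h3 : (κ ^ 2 + freqNormSq l)⁻¹ ≤ m⁻¹ * (1 + freqNormSq l)⁻¹ := by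
      rw [← mul_inv]
      exact inv_anti₀ (by positivity) h2
    have h4 : (1 + freqNormSq l) ^ (-(2 : ℝ)) = ((1 + freqNormSq l)⁻¹) ^ 2 := by
      rw [Real.rpow_neg h1.le, ← Real.rpow_natCast, ← Real.inv_rpow h1.le]
      norm_num
    rw [h4, ← mul_pow]
    exact pow_le_pow_left₀ (inv_nonneg.2 (kappa_sq_add_freqNormSq_pos hκ l).le) h3 2
  calc ∑' l : d → ℤ, ENNReal.ofReal ((κ ^ 2 + freqNormSq l)⁻¹ ^ 2)
      ≤ ∑' l : d → ℤ, ENNReal.ofReal (m⁻¹ ^ 2 * (1 + freqNormSq l) ^ (-(2 : ℝ))) :=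
        ENNReal.tsum_le_tsum fun l => ENNReal.ofReal_le_ofReal (hle l)
    _ = ENNReal.ofReal (∑' l : d → ℤ, m⁻¹ ^ 2 * (1 + freqNormSq l) ^ (-(2 : ℝ))) :=
        (ENNReal.ofReal_tsum_of_nonneg (fun l => mul_nonneg (sq_nonneg _)
          (Real.rpow_nonneg (by linarith [freqNormSq_nonneg l]) _)) (hS.mul_left _)).symm
    _ < ∞ := ENNReal.ofReal_lt_top

end Kappa

/-! ## §4 The instance `κ = 1`: the tree's Sobolev norms `Torus.eSobolevNorm` -/

section Tree

variable {u v : UnitAddTorus d → EuclideanSpace ℝ d}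

omit [DecidableEq d] in
/-- `((1 + |l|²)⁻¹)² = ⟨l⟩₋₂²`: the summand of `σ²` in the tree's weights. -/
theorem inv_one_add_freqNormSq_sq (l : d → ℤ) :
    ((1 : ℝ) ^ 2 + freqNormSq l)⁻¹ ^ 2 = sobolevWeight (-2) l ^ 2 := by
  have h1 : 0 < 1 + freqNormSq l := by linarith [freqNormSq_nonneg l]
  rw [one_pow, sobolevWeight_sq, Real.rpow_neg h1.le, Real.rpow_two, inv_pow]

/-- **The convective product law `H² · H² → H¹` on `T^d`, lattice-norm form** (`κ = 1` of
`kappaWeight_tsum_sq_mFourierCoeff_convect_le`): for smooth real `u, v`, with `û = 𝓕(ℂ∘u)`,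
`v̂ = 𝓕(ℂ∘v)` and the tree's `Lattice.eNormSq` (`⟨k⟩ = (1+|k|²)^{1/2}`),
`‖𝓕(ℂ∘(u·∇)v)‖²_{H_1} ≤ (2π)² · 4 σ² · ‖û‖²_{H_2} ‖v̂‖²_{H_2}`, `σ² = ∑ₗ ⟨l⟩⁻⁴`. -/
theorem eNormSq_one_mFourierCoeff_convect_le (hu : IsSmooth u) (hv : IsSmooth v) :
    eNormSq 1 (mFourierCoeff (EuclideanSpace.complexify ∘ Torus.convect u v)) ≤
      ENNReal.ofReal (2 * Real.pi) ^ 2 *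
        (4 * (∑' l : d → ℤ, ENNReal.ofReal (sobolevWeight (-2) l ^ 2)) *
          (eNormSq 2 (mFourierCoeff (EuclideanSpace.complexify ∘ u)) *
            eNormSq 2 (mFourierCoeff (EuclideanSpace.complexify ∘ v)))) := by
  have h := kappaWeight_tsum_sq_mFourierCoeff_convect_le hu hv one_pos
  have e1 : ∀ k : d → ℤ, (1 : ℝ) ^ 2 + freqNormSq k = sobolevWeight 1 k ^ 2 := fun k => by
    rw [one_pow, sobolevWeight_one_sq]
  have e2 : ∀ l : d → ℤ, ((1 : ℝ) ^ 2 + freqNormSq l) ^ 2 = sobolevWeight 2 l ^ 2 := fun l => by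
    rw [one_pow, sobolevWeight_sq, Real.rpow_two]
  simp only [inv_one_add_freqNormSq_sq, e2] at h
  simp only [e1] at h
  rw [Lattice.eNormSq, Lattice.eNormSq, Lattice.eNormSq]
  exact h

/-- **The convective product law `H² · H² → H¹` on `T^d`, norm form** (C-ALG-DISPLAY §1 on the unit
torus): for smooth real `u, v` on `T^d`, `‖(u·∇)v‖_{H¹} ≤ 4π σ ‖u‖_{H²} ‖v‖_{H²}`,
`σ = (∑ₗ ⟨l⟩⁻⁴)^{1/2}`, all norms the tree's `Torus.eSobolevNorm` of the complexified fields
(`⟨k⟩ = (1+|k|²)^{1/2}`). For `card d ≤ 3`, `σ < ∞` (`tsum_sobolevWeight_neg_two_sq_lt_top`). -/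
theorem eSobolevNorm_one_convect_le (hu : IsSmooth u) (hv : IsSmooth v) :
    eSobolevNorm 1 (EuclideanSpace.complexify ∘ Torus.convect u v) ≤
      ENNReal.ofReal (4 * Real.pi) *
        (∑' l : d → ℤ, ENNReal.ofReal (sobolevWeight (-2) l ^ 2)) ^ (1 / 2 : ℝ) *
        (eSobolevNorm 2 (EuclideanSpace.complexify ∘ u) * eSobolevNorm 2 (EuclideanSpace.complexify ∘ v)) := by
  have hhalf : (0 : ℝ) ≤ 1 / 2 := by norm_num
  have hmono := ENNReal.rpow_le_rpow (eNormSq_one_mFourierCoeff_convect_le hu hv) hhalf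
  rw [eSobolevNorm_eq_eNorm, eSobolevNorm_eq_eNorm, eSobolevNorm_eq_eNorm, Lattice.eNorm, Lattice.eNorm,
    Lattice.eNorm]
  refine hmono.trans (le_of_eq ?_)
  set S := ∑' l : d → ℤ, ENNReal.ofReal (sobolevWeight (-2) l ^ 2)
  set A := eNormSq 2 (mFourierCoeff (EuclideanSpace.complexify ∘ u))
  set B := eNormSq 2 (mFourierCoeff (EuclideanSpace.complexify ∘ v))
  have hc : ENNReal.ofReal (2 * Real.pi) ^ 2 * 4 = ENNReal.ofReal (4 * Real.pi) ^ 2 := by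
    rw [show (4 : ℝ≥0∞) = 2 ^ 2 by norm_num, ← mul_pow, show (2 : ℝ≥0∞) = ENNReal.ofReal 2 by norm_num,
      ← ENNReal.ofReal_mul (by positivity)]
    congr 1; ring_nf
  rw [show ENNReal.ofReal (2 * Real.pi) ^ 2 * (4 * S * (A * B)) =
      ENNReal.ofReal (4 * Real.pi) ^ 2 * S * (A * B) by rw [← hc]; ring,
    ENNReal.mul_rpow_of_nonneg _ _ hhalf, ENNReal.mul_rpow_of_nonneg _ _ hhalf,
    ENNReal.mul_rpow_of_nonneg _ _ hhalf, Lattice.ennreal_sq_rpow_half]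

omit [DecidableEq d] in
/-- **`σ² = ∑ₗ ⟨l⟩⁻⁴ < ∞` in dimension `≤ 3`** (the lattice `p`-series with `2s = 4 > card d`). -/
theorem tsum_sobolevWeight_neg_two_sq_lt_top (hd : Fintype.card d ≤ 3) :
    ∑' l : d → ℤ, ENNReal.ofReal (sobolevWeight (-2) l ^ 2) < ∞ := by
  simpa only [inv_one_add_freqNormSq_sq] using tsum_kappaWeight_inv_sq_lt_top hd one_pos

end Tree

end Summit.NavierStokesRegularity.FluidComputer.ConvectiveProductLawBooking

end
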